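import Summits.Ventures.PercRepro.MSTightConnected
import Summits.Ventures.PercRepro.MSTightDichotomy

/-!
# Split families of excess one: the projection is tight

The failing column of Lemma B in the regime «some pair-type has exactly two pairs» is a family `F`
of finite sets that is SPLIT (a partition into two nonempty parts with no comparable pair across:
`¬ NoSplit F`), whose difference family `F \\ F` is a DOWN-SET containing every singleton of the
support, and which has EXCESS ONE in Marica–Schönheim: `|F \\ F| = |F| + 1` (proofs/P4-gen9.md §1(c),
§7). This file proves the first structural fact about such families (§7 (P1)):

* `tight_proj_of_split_excess_one`: for every coordinate `r` with `{r} ∈ F \\ F`, the projection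
  `proj r F` (every member with `r` removed) is TIGHT, and the `r`-differences number exactly one
  more than the `r`-twin pairs: `|diffsY r F| = |partner r F| + 1`.

Proof. With a down-closed difference family `Y ⊆ X` (`diffsY_subset_diffsX`), so
`|F \\ F| = |proj r F \\ proj r F| + |Y|` while `|F| = |proj r F| + |K|`, `|proj r F| ≤ |proj \\ proj|`
and `|K| ≤ |K \\ K| ≤ |Y|` (Marica–Schönheim twice); excess one leaves exactly one unit of slack. If it
sat in the projection (`|proj \\ proj| = |proj| + 1`, `Y = K \\ K`, `K` tight and nonempty because
`∅ ∈ Y` comes from `{r} ∈ F \\ F`), Lemma 3 (`subset_of_diffs_mem`) and its dual would make every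
member of `F` comparable to a member of `K ∪ (K + r)`, which is unsplittable because `K` is tight
(`noSplit_of_tight`, `noSplit_of_attached`) — contradicting the split. Hence the slack sits in `Y`.
-/

namespace PercRepro.MSTight

open Finset
open scoped FinsetFamily

variable {α : Type*} [DecidableEq α]

/-- Every member of the partner family and every `r`-lift of it lies in `F`. -/
theorem partner_lift_subset {r : α} {F : Finset (Finset α)} :
    partner r F ∪ (partner r F).image (insert r) ⊆ F := by
  intro A hA
  rcases Finset.mem_union.1 hA with h | h
  · exact (mem_part0.1 (Finset.mem_inter.1 h).1).1
  · obtain ⟨E, hE, rfl⟩ := Finset.mem_image.1 h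
    exact (mem_partr.1 (Finset.mem_inter.1 hE).2).2

/-- The family `K ∪ (K + r)` is unsplittable when `K` is tight (every lift `insert r E` is
comparable to `E`). -/
theorem noSplit_partner_union_lifts {r : α} {F : Finset (Finset α)} (u : Finset α)
    (hFu : ∀ A ∈ F, A ⊆ u) (hK : Tight (partner r F)) :
    NoSplit (partner r F ∪ (partner r F).image (insert r)) := by
  have hKu : ∀ E ∈ partner r F, E ⊆ u := fun E hE =>
    hFu E (mem_part0.1 (Finset.mem_inter.1 hE).1).1
  refine noSplit_of_attached Finset.subset_union_left (noSplit_of_tight u _ hKu hK) ?_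
  intro A hA
  rcases Finset.mem_union.1 hA with h | h
  · exact ⟨A, h, Or.inl le_rfl⟩
  · obtain ⟨E, hE, rfl⟩ := Finset.mem_image.1 h
    exact ⟨E, hE, Or.inr (Finset.subset_insert r E)⟩

/-- **(P1): the projection of a split family of excess one is tight**, and the `r`-differences
are one more than the `r`-twin pairs. Hypotheses: `F` is split (`¬ NoSplit F`), `F \\ F` is a
down-set, `|F \\ F| = |F| + 1`, and `{r}` is a difference. -/
theorem tight_proj_of_split_excess_one {F : Finset (Finset α)} (u : Finset α)
    (hFu : ∀ A ∈ F, A ⊆ u) (hsplit : ¬ NoSplit F) (hD : IsDownSet (F \\ F))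
    (hexc : (F \\ F).card = F.card + 1) {r : α} (hr : ({r} : Finset α) ∈ F \\ F) :
    Tight (proj r F) ∧ (diffsY r F).card = (partner r F).card + 1 := by
  have hYX : diffsY r F ⊆ diffsX r F := diffsY_subset_diffsX hD
  have hXY : diffsX r F ∩ diffsY r F = diffsY r F := Finset.inter_eq_right.2 hYX
  have h1 := card_diffs_eq_card_diffs_proj_add r F
  rw [hXY] at h1
  have h2 := card_eq_card_proj_add_card_partner r F
  have h3 : (proj r F).card ≤ (proj r F \\ proj r F).card := Finset.card_le_card_diffs _
  have h4 : (partner r F).card ≤ (partner r F \\ partner r F).card := Finset.card_le_card_diffs _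
  have h5 : partner r F \\ partner r F ⊆ diffsY r F := fun E hE =>
    (Finset.mem_inter.1 (diffs_partner_subset r F hE)).2
  have h6 : (partner r F \\ partner r F).card ≤ (diffsY r F).card := Finset.card_le_card h5
  -- `∅ ∈ Y` since `{r}` is a difference
  have h0 : (∅ : Finset α) ∈ diffsY r F := by
    obtain ⟨A, hA, B, hB, hAB⟩ := Finset.mem_diffs.1 hr
    have hrA : r ∈ A := by
      have : r ∈ A \ B := by rw [hAB]; exact Finset.mem_singleton_self r
      exact (Finset.mem_sdiff.1 this).1
    have hrB : r ∉ B := by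
      have : r ∈ A \ B := by rw [hAB]; exact Finset.mem_singleton_self r
      exact (Finset.mem_sdiff.1 this).2
    refine Finset.mem_diffs.2 ⟨A.erase r, mem_partr.2 ⟨Finset.notMem_erase r A, by
      rw [Finset.insert_erase hrA]; exact hA⟩, B, mem_part0.2 ⟨hB, hrB⟩, ?_⟩
    -- `(A.erase r) \ B = (A \ B).erase r = {r}.erase r = ∅`
    have hcomm : A.erase r \ B = (A \ B).erase r := by
      ext x
      simp only [Finset.mem_sdiff, Finset.mem_erase]
      tauto
    rw [hcomm, hAB, Finset.erase_singleton]
  -- the one unit of slack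
  by_cases hproj : Tight (proj r F)
  · refine ⟨hproj, ?_⟩
    unfold Tight at hproj
    omega
  · exfalso
    -- the slack sits in the projection: `Y = K \\ K` and `K` is tight
    have hprojlt : (proj r F).card + 1 ≤ (proj r F \\ proj r F).card := by
      unfold Tight at hproj; omega
    have hYK : (diffsY r F).card = (partner r F).card := by omega
    have hKt : Tight (partner r F) := by unfold Tight; omega
    have hYeq : diffsY r F = partner r F \\ partner r F :=
      (Finset.eq_of_subset_of_card_le h5 (by omega)).symm
    have hKne : (partner r F).Nonempty := by
      rw [hYeq] at h0
      obtain ⟨E, hE, -, -, -⟩ := Finset.mem_diffs.1 h0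
      exact ⟨E, hE⟩
    -- every member of `F` is comparable to a member of `K ∪ (K + r)`
    set C := partner r F ∪ (partner r F).image (insert r) with hC
    have hCF : C ⊆ F := partner_lift_subset
    have hatt : ∀ A ∈ F, ∃ c ∈ C, A ⊆ c ∨ c ⊆ A := by
      intro A hA
      have hKu : ∀ E ∈ partner r F, E ⊆ u := fun E hE =>
        hFu E (mem_part0.1 (Finset.mem_inter.1 hE).1).1
      by_cases hrA : r ∈ A
      · -- `A = insert r P`; either `P ∈ K`, or `P` is a pure `r`-member below some `E ∈ K`
        set P := A.erase r with hP
        have hPr : P ∈ partr r F := mem_partr.2 ⟨Finset.notMem_erase r A, by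
          rw [hP, Finset.insert_erase hrA]; exact hA⟩
        by_cases hP0 : P ∈ part0 r F
        · refine ⟨P, Finset.mem_union.2 (Or.inl (Finset.mem_inter.2 ⟨hP0, hPr⟩)),
            Or.inr (Finset.erase_subset r A)⟩
        · have hdiff : ∀ E ∈ partner r F, P \ E ∈ partner r F \\ partner r F := by
            intro E hE
            rw [← hYeq]
            exact Finset.mem_diffs.2 ⟨P, hPr, E, (Finset.mem_inter.1 hE).1, rfl⟩
          obtain ⟨E, hE, hPE⟩ := subset_of_diffs_mem u (partner r F) P hKu
            ((Finset.erase_subset r A).trans (hFu A hA)) hKne hKt hdiff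
          refine ⟨insert r E, Finset.mem_union.2 (Or.inr (Finset.mem_image.2 ⟨E, hE, rfl⟩)),
            Or.inl ?_⟩
          intro x hx
          by_cases hxr : x = r
          · rw [hxr]; exact Finset.mem_insert_self r E
          · exact Finset.mem_insert_of_mem (hPE (Finset.mem_erase.2 ⟨hxr, hx⟩))
      · -- `A` avoids `r`: either `A ∈ K`, or `A` is a pure `0`-member above some `E ∈ K`
        have hA0 : A ∈ part0 r F := mem_part0.2 ⟨hA, hrA⟩
        by_cases hAr : A ∈ partr r F
        · exact ⟨A, Finset.mem_union.2 (Or.inl (Finset.mem_inter.2 ⟨hA0, hAr⟩)), Or.inl le_rfl⟩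
        · have hdiff : ∀ E ∈ partner r F, E \ A ∈ partner r F \\ partner r F := by
            intro E hE
            rw [← hYeq]
            exact Finset.mem_diffs.2 ⟨E, (Finset.mem_inter.1 hE).2, A, hA0, rfl⟩
          obtain ⟨E, hE, hEA⟩ := exists_subset_of_sdiff_mem u (partner r F) A hKu (hFu A hA)
            hKne hKt hdiff
          exact ⟨E, Finset.mem_union.2 (Or.inl hE), Or.inr hEA⟩
    exact hsplit (noSplit_of_attached hCF (noSplit_partner_union_lifts u hFu hKt) hatt)

end PercRepro.MSTight
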